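/-
Copyright (c) 2026 the pub-hodgecm-mathlib formalisation cell (harness21).  Prover seat hodgecm-mathlib-K2Liu-p01 (g10), Track B «K2-LIT»,
#184♮ = hLiu418 = `stmt-HodgeConjecture-24832`; #42S organ S1 ROAD W, (G) organ (ρ-mid), brick (M2a-L) named by K2Liu-p26 (g0) 2026-09-04T15:55:56Z
(desk cut K2Liu-p01 (g10) 15:55:39Z): THE LATTICE-PAIR WITNESS READ ALONG A LEVI ROW — `(𝟙_{B₁(k)} − 𝟙_{B₂(k)})(α·a, β·a, γ·a) = 𝟙[|α| ≤ ρ]·𝟙[|β| = ρ]·𝟙[|γ| ≤ ρ|ϖ|^k]`,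
`ρ = (max_j |a_j|)⁻¹`, plus the (M2b) side letters of these three sets.
-/
import Summits.HodgeConjecture.HodgeConjecture.Theorems.K2LiuSkewLatticeShells            -- ★ `isOpen_setOf_valued_le`, `isCompact_setOf_valued_le`, `exists_setOf_valued_le_eq_primePowBall`
import Mathlib.MeasureTheory.Constructions.BorelSpace.Basic
import HarnessLib

/-!
# Crux `HLiu418`, #42S-S1 ROAD W, (G) organ (ρ-mid), brick (M2a-L): THE LATTICE-PAIR WITNESS READ ALONG A LEVI ROW

Cell `hodgecm-mathlib`, crux item hLiu418 = `stmt-HodgeConjecture-24832` (helper lane `--supports … --as helper`, count-neutral).  THEOREMS ONLY (no `def`, no instance,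
no notation, no named-fact hypothesis, no `sorry`).  Generic number-field extension `E/F`, finite place `v` of `F` with uniformiser `π` (`hπ`), a place `w₀ ∣ v` at which
`ϖ := ι_{w₀}(π)` is a uniformiser (`hπw : v_{w₀}(ϖ) = exp(−1)` — the inert unramified letter of ★ (H4)∕★ FILE B `K2LiuLocalSWSpanningInertDyadic`), `K = E_{w₀}`,
`P := v_{w₀}(ϖ)`.

WHY (K2Liu-p26 (g0) (M2a) CUT OF RECORD 15:57:04Z (C1)–(C3); desk K2Liu-p01 (g10) 15:55:39Z).  The middle-cell row of the (G) organ evaluates the local Siegel–Weil section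
of the lattice-pair witness `Φ_ε` at `w₁·n(h)·m(a)` (`w₁` the partial flip at the `W`-index `i`): by (C1)–(C3), `F_{Φ_ε}(w₁·n(h)·m(a)) = K_ε·χ_s(det a)·∫_{V′} ψ(−h_{ii}Q_ε(y)∕d)·
(Γ_εΦ_ε)((y,0)·a) dy`, and in the frame coordinate `κ` of ★ (H4) (rows (K1)∕(K2)) the vector `(y,0)·a ∈ X` has coordinates `(α·a_{i·}, β·a_{i·}, γ·a_{i·})`, `(α, β, γ) ∈ K³`
the hyperbolic-frame coordinates of `y ∈ V′`, `a_{i·} = (a_{i0}, a_{i1}) ≠ 0` the `i`-th row of `a ∈ GL₂(K)`.  The READING of ★ (H4)∕FILE B is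
`⇑(Γ_εΦ_ε) = 𝟙_{κ⁻¹B₁(k)} − 𝟙_{κ⁻¹B₂(k)}` with `B₁(k) = {a-part ∈ 𝒪², b-part ∈ 𝒪², c-part ∈ ϖ^k𝒪²}`, `B₂(k) = B₁(k) ∩ {b-part ∈ ϖ𝒪²}`.  THIS FILE reads that
difference along the Levi row (pure valuation algebra in `K`, FILE B's set bytes verbatim):
* §1 discreteness at `w₀`: `v(z) = P^n` for `z ≠ 0` (`exists_valued_eq_zpow`); THE SHELL `v z ≤ P^n ∧ ¬ v z ≤ P^{n+1} ↔ v z = P^n` (`valued_le_and_not_le_iff_eq`);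
* §2 the exponent of a non-zero row: `∃ n, (∀ j, v(a_j) ≤ P^{−n}) ∧ ∃ j, v(a_j) = P^{−n}` (`exists_row_exponent`), and the SCALING `(∀ j, v(z·a_j) ≤ P^m) ↔ v z ≤ P^{m+n}`;
* §3 THE READING: membership of `(α·a, β·a, γ·a)` in `B₁(k)`, `B₂(k)` (`mem_boxOne_iff`, `mem_boxTwo_iff`) and
  **`indicator_boxOne_sub_boxTwo_levi`**: `(𝟙_{B₁(k)} − 𝟙_{B₂(k)})(α·a, β·a, γ·a) = 𝟙[v α ≤ P^n ∧ v β = P^n ∧ v γ ≤ P^{n+k}]` = `𝟙_{(U ×ˢ C) ×ˢ B}((β, γ), α)` with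
  `B = {v ≤ P^n}`, `U = {v = P^n}` (a shell), `C = {v ≤ P^{n+k}}` (`indicator_boxOne_sub_boxTwo_levi_eq_indicator_prod`) — the integration domain of ★ (M2b)
  `K2LiuMiddleProfileFactorisation.factorisation_of_middleProfile(_balls)` in its `((β, γ), α)` order, all three sets FRAME-INDEPENDENT (no `D_ε`);
* §4 the (M2b) side letters for these sets: `exists_addSubgroup_ball` (`hB`), `measurableSet_ball∕shell`, `measure_ball∕shell_lt_top` (`hBm hBμ hU hUμ hC hCμ`), `shell_letter`
  (`hUsh`, `ρ′ = ρ = P^n`), `ball_box_letter` (`hCbox`: `v(D·γ·σγ) ≤ P^n·P^n` on `C` once `v(D)·P^{2k} ≤ 1` — at `v ∤ 2` any `k` for `|D| ≤ 1`; with `D := D_ε∕2` at a dyadic `w₀`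
  it is the depth condition `2k ≥ ord_{w₀}(2)`, `valued_mul_zpow_le_one`).
[Kudla1994, §3 Thm. 3.1] [KudlaSweet1997, §1] [WeilBNT1967, Ch. II §5 Prop. 12] [CasselsFrohlichANT1967, Ch. II §10] [Shimura1997, §13.2].
HONEST LABEL.  Count-neutral helper; `HC_CM` is proved only modulo the 7 printed citations (2 remaining named inputs: hLiu418 = `stmt-HodgeConjecture-24832`,
h413 = `stmt-HodgeConjecture-24833`) until rung 0 closes.  NOT here: (C1)–(C3) (K2Liu-p26), the κ-coordinates of `(y,0)·a` (row (K1)), ★ (M2b), the (G) assembly.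

## References
* [Kudla1994] S. S. Kudla, Israel J. Math. 87 (1994), §3 Thm. 3.1.
* [KudlaSweet1997] S. Kudla, W. J. Sweet, Israel J. Math. 98 (1997), §1.
* [WeilBNT1967] A. Weil, *Basic Number Theory* (1967), Ch. II §5 Prop. 12.
* [CasselsFrohlichANT1967] Cassels–Fröhlich, *Algebraic Number Theory* (1967), Ch. II §10.
* [Shimura1997] G. Shimura, *Euler Products and Eisenstein Series*, CBMS 93 (1997), §13.2.
-/

set_option autoImplicit false
set_option linter.dupNamespace false -- the mandated namespace repeats `HodgeConjecture.HodgeConjecture`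

noncomputable section

open NumberField IsDedekindDomain MeasureTheory Set
open scoped ENNReal
open Literature.NumberTheory.Automorphic Literature.NumberTheory.Automorphic.UnitaryGroup
open Literature.NumberTheory.GaloisRepresentations.IsNonarchimedeanLocalField

namespace Summit.HodgeConjecture.HodgeConjecture.Cruxes.HLiu418.K2LiuWitnessLeviReading

open K2LiuLocalRingValuationBalls K2LiuSkewLatticeShells

variable (F : Type) [Field F] [NumberField F] (E : Type) [Field E] [NumberField E] [Algebra F E]
  (v : HeightOneSpectrum (𝓞 F)) {π : v.adicCompletion F} (hπ : Valued.v π = WithZero.exp (-1 : ℤ))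
  (w₀ : PlacesOver E v) (hπw : Valued.v (toPlace v w₀ π) = WithZero.exp (-1 : ℤ))

/-! ## §1 Discreteness at `w₀` and the shell -/

include hπw in
/-- `P^n = exp(−n)` for the uniformiser threshold `P = v_{w₀}(ϖ)`. [cite: CasselsFrohlichANT1967, Ch. II §10] -/
theorem zpow_valued_toPlace_eq_exp (n : ℤ) : Valued.v (toPlace v w₀ π) ^ n = WithZero.exp (-n) := by
  rw [hπw, ← WithZero.exp_zsmul, smul_eq_mul, mul_neg, mul_one]

include hπw in
/-- **every non-zero `z ∈ E_{w₀}` has `v(z) = P^n` for some `n ∈ ℤ`** (`ϖ` is a uniformiser at `w₀`). [cite: CasselsFrohlichANT1967, Ch. II §10] -/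
theorem exists_valued_eq_zpow {z : w₀.1.adicCompletion E} (hz : z ≠ 0) : ∃ n : ℤ, Valued.v z = Valued.v (toPlace v w₀ π) ^ n := by
  refine ⟨-WithZero.log (Valued.v z), ?_⟩
  rw [zpow_valued_toPlace_eq_exp F E v w₀ hπw, neg_neg, WithZero.exp_log ((Valuation.ne_zero_iff _).2 hz)]

include hπw in
/-- **THE SHELL**: `v z ≤ P^n ∧ ¬ v z ≤ P^{n+1} ↔ v z = P^n`. [cite: WeilBNT1967, Ch. II §5 Prop. 12] [cite: CasselsFrohlichANT1967, Ch. II §10] -/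
theorem valued_le_and_not_le_iff_eq (z : w₀.1.adicCompletion E) (n : ℤ) :
    (Valued.v z ≤ Valued.v (toPlace v w₀ π) ^ n ∧ ¬ Valued.v z ≤ Valued.v (toPlace v w₀ π) ^ (n + 1)) ↔ Valued.v z = Valued.v (toPlace v w₀ π) ^ n := by
  by_cases hz : z = 0
  · subst hz
    simp only [map_zero, zero_le, not_true_eq_false, and_false, false_iff]
    rw [zpow_valued_toPlace_eq_exp F E v w₀ hπw]
    exact WithZero.zero_ne_coe
  obtain ⟨m, hm⟩ := exists_valued_eq_zpow F E v w₀ hπw hz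
  rw [hm, zpow_valued_toPlace_eq_exp F E v w₀ hπw, zpow_valued_toPlace_eq_exp F E v w₀ hπw, zpow_valued_toPlace_eq_exp F E v w₀ hπw,
    WithZero.exp_le_exp, WithZero.exp_le_exp, (WithZero.exp_injective).eq_iff]
  omega

/-! ## §2 The exponent of a non-zero row and the scaling -/

include hπw in
/-- **THE EXPONENT OF A NON-ZERO ROW** `a = (a₀, a₁) ≠ 0`: `max_j v(a_j) = P^{−n}` for some `n ∈ ℤ`. [cite: CasselsFrohlichANT1967, Ch. II §10] -/
theorem exists_row_exponent (a : Fin 2 → w₀.1.adicCompletion E) (ha : a ≠ 0) :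
    ∃ n : ℤ, (∀ j, Valued.v (a j) ≤ Valued.v (toPlace v w₀ π) ^ (-n)) ∧ ∃ j, Valued.v (a j) = Valued.v (toPlace v w₀ π) ^ (-n) := by
  -- the index of the larger valuation
  obtain ⟨j₀, hj₀⟩ : ∃ j₀ : Fin 2, ∀ j, Valued.v (a j) ≤ Valued.v (a j₀) := by
    rcases le_total (Valued.v (a 0)) (Valued.v (a 1)) with h | h
    · exact ⟨1, fun j => by fin_cases j <;> simp [h]⟩
    · exact ⟨0, fun j => by fin_cases j <;> simp [h]⟩
  have hj₀0 : a j₀ ≠ 0 := by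
    intro h0
    apply ha
    funext j
    have hj := hj₀ j
    rw [h0, map_zero, le_zero_iff, Valuation.zero_iff] at hj
    exact hj
  obtain ⟨m, hm⟩ := exists_valued_eq_zpow F E v w₀ hπw hj₀0
  exact ⟨-m, fun j => by rw [neg_neg, ← hm]; exact hj₀ j, j₀, by rw [neg_neg, hm]⟩

include hπ in
/-- **THE SCALING**: if `max_j v(a_j) = P^{−n}` then `(∀ j, v(z·a_j) ≤ P^m) ↔ v z ≤ P^{m+n}`. [cite: CasselsFrohlichANT1967, Ch. II §10] -/
theorem forall_valued_mul_le_iff {a : Fin 2 → w₀.1.adicCompletion E} {n : ℤ} (hle : ∀ j, Valued.v (a j) ≤ Valued.v (toPlace v w₀ π) ^ (-n))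
    (heq : ∃ j, Valued.v (a j) = Valued.v (toPlace v w₀ π) ^ (-n)) (z : w₀.1.adicCompletion E) (m : ℤ) :
    (∀ j, Valued.v (z * a j) ≤ Valued.v (toPlace v w₀ π) ^ m) ↔ Valued.v z ≤ Valued.v (toPlace v w₀ π) ^ (m + n) := by
  have hP : Valued.v (toPlace v w₀ π) ≠ 0 := valued_toPlace_uniformizer_ne_zero F E v hπ w₀
  have hPn : 0 < Valued.v (toPlace v w₀ π) ^ (-n) := zpow_pos (zero_lt_iff.2 hP) _
  constructor
  · intro h
    obtain ⟨j, hj⟩ := heq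
    have h1 := h j
    rw [map_mul, hj, ← le_div_iff₀ hPn, ← zpow_sub₀ hP, sub_neg_eq_add] at h1
    exact h1
  · intro h j
    rw [map_mul]
    calc Valued.v z * Valued.v (a j) ≤ Valued.v (toPlace v w₀ π) ^ (m + n) * Valued.v (toPlace v w₀ π) ^ (-n) := mul_le_mul' h (hle j)
      _ = Valued.v (toPlace v w₀ π) ^ m := by rw [← zpow_add₀ hP]; congr 1; ring

/-! ## §3 THE READING of `𝟙_{B₁(k)} − 𝟙_{B₂(k)}` along the Levi row `(α·a, β·a, γ·a)` -/

include hπ in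
/-- membership of the Levi row in the OUTER box `B₁(k)` (bytes of ★ (H4)∕FILE B). [cite: Kudla1994, §3 Thm. 3.1] [cite: Shimura1997, §13.2] -/
theorem mem_boxOne_iff {a : Fin 2 → w₀.1.adicCompletion E} {n : ℤ} (hle : ∀ j, Valued.v (a j) ≤ Valued.v (toPlace v w₀ π) ^ (-n))
    (heq : ∃ j, Valued.v (a j) = Valued.v (toPlace v w₀ π) ^ (-n)) (k : ℕ) (α β γ : w₀.1.adicCompletion E) :
    ((fun j => α * a j, fun j => β * a j, fun j => γ * a j) : (Fin 2 → w₀.1.adicCompletion E) × (Fin 2 → w₀.1.adicCompletion E) × (Fin 2 → w₀.1.adicCompletion E)) ∈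
      {y : ((Fin 2 → w₀.1.adicCompletion E) × (Fin 2 → w₀.1.adicCompletion E) × (Fin 2 → w₀.1.adicCompletion E)) |
        (∀ i, Valued.v (y.1 i) ≤ 1) ∧ (∀ i, Valued.v (y.2.1 i) ≤ 1) ∧ ∀ i, Valued.v (y.2.2 i) ≤ Valued.v (toPlace v w₀ π) ^ k} ↔
    Valued.v α ≤ Valued.v (toPlace v w₀ π) ^ n ∧ Valued.v β ≤ Valued.v (toPlace v w₀ π) ^ n ∧ Valued.v γ ≤ Valued.v (toPlace v w₀ π) ^ (n + k) := by
  have h0 : ∀ z : w₀.1.adicCompletion E, (∀ j, Valued.v (z * a j) ≤ 1) ↔ Valued.v z ≤ Valued.v (toPlace v w₀ π) ^ n := fun z => by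
    have h := forall_valued_mul_le_iff F E v hπ w₀ hle heq z 0
    rwa [zpow_zero, zero_add] at h
  have hk : ∀ z : w₀.1.adicCompletion E, (∀ j, Valued.v (z * a j) ≤ Valued.v (toPlace v w₀ π) ^ k) ↔ Valued.v z ≤ Valued.v (toPlace v w₀ π) ^ (n + k) := fun z => by
    have h := forall_valued_mul_le_iff F E v hπ w₀ hle heq z k
    rwa [zpow_natCast, add_comm (k : ℤ) n] at h
  simp only [Set.mem_setOf_eq]
  rw [h0 α, h0 β, hk γ]

include hπ in
/-- membership of the Levi row in the INNER box `B₂(k) = B₁(k) ∩ {b-part ∈ ϖ𝒪²}` (bytes of ★ (H4)∕FILE B). [cite: Kudla1994, §3 Thm. 3.1] [cite: Shimura1997, §13.2] -/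
theorem mem_boxTwo_iff {a : Fin 2 → w₀.1.adicCompletion E} {n : ℤ} (hle : ∀ j, Valued.v (a j) ≤ Valued.v (toPlace v w₀ π) ^ (-n))
    (heq : ∃ j, Valued.v (a j) = Valued.v (toPlace v w₀ π) ^ (-n)) (k : ℕ) (α β γ : w₀.1.adicCompletion E) :
    ((fun j => α * a j, fun j => β * a j, fun j => γ * a j) : (Fin 2 → w₀.1.adicCompletion E) × (Fin 2 → w₀.1.adicCompletion E) × (Fin 2 → w₀.1.adicCompletion E)) ∈
      {y : ((Fin 2 → w₀.1.adicCompletion E) × (Fin 2 → w₀.1.adicCompletion E) × (Fin 2 → w₀.1.adicCompletion E)) |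
        ((∀ i, Valued.v (y.1 i) ≤ 1) ∧ (∀ i, Valued.v (y.2.1 i) ≤ 1) ∧ ∀ i, Valued.v (y.2.2 i) ≤ Valued.v (toPlace v w₀ π) ^ k) ∧
          ∀ i, Valued.v (y.2.1 i) ≤ Valued.v (toPlace v w₀ π)} ↔
    (Valued.v α ≤ Valued.v (toPlace v w₀ π) ^ n ∧ Valued.v β ≤ Valued.v (toPlace v w₀ π) ^ n ∧ Valued.v γ ≤ Valued.v (toPlace v w₀ π) ^ (n + k)) ∧
      Valued.v β ≤ Valued.v (toPlace v w₀ π) ^ (n + 1) := by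
  have h0 : ∀ z : w₀.1.adicCompletion E, (∀ j, Valued.v (z * a j) ≤ 1) ↔ Valued.v z ≤ Valued.v (toPlace v w₀ π) ^ n := fun z => by
    have h := forall_valued_mul_le_iff F E v hπ w₀ hle heq z 0
    rwa [zpow_zero, zero_add] at h
  have hk : ∀ z : w₀.1.adicCompletion E, (∀ j, Valued.v (z * a j) ≤ Valued.v (toPlace v w₀ π) ^ k) ↔ Valued.v z ≤ Valued.v (toPlace v w₀ π) ^ (n + k) := fun z => by
    have h := forall_valued_mul_le_iff F E v hπ w₀ hle heq z k
    rwa [zpow_natCast, add_comm (k : ℤ) n] at h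
  have h1 : ∀ z : w₀.1.adicCompletion E, (∀ j, Valued.v (z * a j) ≤ Valued.v (toPlace v w₀ π)) ↔ Valued.v z ≤ Valued.v (toPlace v w₀ π) ^ (n + 1) := fun z => by
    have h := forall_valued_mul_le_iff F E v hπ w₀ hle heq z 1
    rwa [zpow_one, add_comm (1 : ℤ) n] at h
  simp only [Set.mem_setOf_eq]
  rw [h0 α, h0 β, hk γ, h1 β]

include hπ hπw in
open scoped Classical in
/-- **THE LATTICE-PAIR WITNESS READ ALONG A LEVI ROW**: `(𝟙_{B₁(k)} − 𝟙_{B₂(k)})(α·a, β·a, γ·a) = 𝟙[v α ≤ P^n ∧ v β = P^n ∧ v γ ≤ P^{n+k}]` (`P^{−n} = max_j v(a_j)`):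
the `b`-coordinate lands on the SHELL `v β = P^n`. [cite: Kudla1994, §3 Thm. 3.1] [cite: KudlaSweet1997, §1] [cite: WeilBNT1967, Ch. II §5 Prop. 12] -/
theorem indicator_boxOne_sub_boxTwo_levi {a : Fin 2 → w₀.1.adicCompletion E} {n : ℤ} (hle : ∀ j, Valued.v (a j) ≤ Valued.v (toPlace v w₀ π) ^ (-n))
    (heq : ∃ j, Valued.v (a j) = Valued.v (toPlace v w₀ π) ^ (-n)) (k : ℕ) (α β γ : w₀.1.adicCompletion E) :
    {y : ((Fin 2 → w₀.1.adicCompletion E) × (Fin 2 → w₀.1.adicCompletion E) × (Fin 2 → w₀.1.adicCompletion E)) |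
        (∀ i, Valued.v (y.1 i) ≤ 1) ∧ (∀ i, Valued.v (y.2.1 i) ≤ 1) ∧ ∀ i, Valued.v (y.2.2 i) ≤ Valued.v (toPlace v w₀ π) ^ k}.indicator (fun _ => (1 : ℂ))
        ((fun j => α * a j, fun j => β * a j, fun j => γ * a j)) -
      {y : ((Fin 2 → w₀.1.adicCompletion E) × (Fin 2 → w₀.1.adicCompletion E) × (Fin 2 → w₀.1.adicCompletion E)) |
        ((∀ i, Valued.v (y.1 i) ≤ 1) ∧ (∀ i, Valued.v (y.2.1 i) ≤ 1) ∧ ∀ i, Valued.v (y.2.2 i) ≤ Valued.v (toPlace v w₀ π) ^ k) ∧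
          ∀ i, Valued.v (y.2.1 i) ≤ Valued.v (toPlace v w₀ π)}.indicator (fun _ => (1 : ℂ))
        ((fun j => α * a j, fun j => β * a j, fun j => γ * a j)) =
    if Valued.v α ≤ Valued.v (toPlace v w₀ π) ^ n ∧ Valued.v β = Valued.v (toPlace v w₀ π) ^ n ∧ Valued.v γ ≤ Valued.v (toPlace v w₀ π) ^ (n + k) then 1 else 0 := by
  have e1 := if_congr (mem_boxOne_iff F E v hπ w₀ hle heq k α β γ) (rfl : (1 : ℂ) = 1) (rfl : (0 : ℂ) = 0)
  have e2 := if_congr (mem_boxTwo_iff F E v hπ w₀ hle heq k α β γ) (rfl : (1 : ℂ) = 1) (rfl : (0 : ℂ) = 0)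
  rw [Set.indicator_apply, Set.indicator_apply, e1, e2]
  have hsh := (valued_le_and_not_le_iff_eq F E v w₀ hπw β n).symm
  by_cases hα : Valued.v α ≤ Valued.v (toPlace v w₀ π) ^ n <;>
  by_cases hβ : Valued.v β ≤ Valued.v (toPlace v w₀ π) ^ n <;>
  by_cases hβ' : Valued.v β ≤ Valued.v (toPlace v w₀ π) ^ (n + 1) <;>
  by_cases hγ : Valued.v γ ≤ Valued.v (toPlace v w₀ π) ^ (n + k) <;>
  simp [hα, hβ, hβ', hγ, hsh]

include hπ hπw in
open scoped Classical in
/-- **THE SAME READING AS A PRODUCT-SET INDICATOR** in ★ (M2b)'s integration order `((β, γ), α) ∈ (U ×ˢ C) ×ˢ B` with the FRAME-INDEPENDENT sets `B = {v ≤ P^n}`,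
`U = {v = P^n}`, `C = {v ≤ P^{n+k}}`. [cite: Kudla1994, §3 Thm. 3.1] [cite: KudlaSweet1997, §1] -/
theorem indicator_boxOne_sub_boxTwo_levi_eq_indicator_prod {a : Fin 2 → w₀.1.adicCompletion E} {n : ℤ}
    (hle : ∀ j, Valued.v (a j) ≤ Valued.v (toPlace v w₀ π) ^ (-n)) (heq : ∃ j, Valued.v (a j) = Valued.v (toPlace v w₀ π) ^ (-n)) (k : ℕ)
    (α β γ : w₀.1.adicCompletion E) :
    {y : ((Fin 2 → w₀.1.adicCompletion E) × (Fin 2 → w₀.1.adicCompletion E) × (Fin 2 → w₀.1.adicCompletion E)) |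
        (∀ i, Valued.v (y.1 i) ≤ 1) ∧ (∀ i, Valued.v (y.2.1 i) ≤ 1) ∧ ∀ i, Valued.v (y.2.2 i) ≤ Valued.v (toPlace v w₀ π) ^ k}.indicator (fun _ => (1 : ℂ))
        ((fun j => α * a j, fun j => β * a j, fun j => γ * a j)) -
      {y : ((Fin 2 → w₀.1.adicCompletion E) × (Fin 2 → w₀.1.adicCompletion E) × (Fin 2 → w₀.1.adicCompletion E)) |
        ((∀ i, Valued.v (y.1 i) ≤ 1) ∧ (∀ i, Valued.v (y.2.1 i) ≤ 1) ∧ ∀ i, Valued.v (y.2.2 i) ≤ Valued.v (toPlace v w₀ π) ^ k) ∧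
          ∀ i, Valued.v (y.2.1 i) ≤ Valued.v (toPlace v w₀ π)}.indicator (fun _ => (1 : ℂ))
        ((fun j => α * a j, fun j => β * a j, fun j => γ * a j)) =
    (({z : w₀.1.adicCompletion E | Valued.v z = Valued.v (toPlace v w₀ π) ^ n} ×ˢ {z : w₀.1.adicCompletion E | Valued.v z ≤ Valued.v (toPlace v w₀ π) ^ (n + k)}) ×ˢ
        {z : w₀.1.adicCompletion E | Valued.v z ≤ Valued.v (toPlace v w₀ π) ^ n}).indicator (fun _ => (1 : ℂ)) ((β, γ), α) := by
  rw [indicator_boxOne_sub_boxTwo_levi F E v hπ w₀ hπw hle heq k α β γ, Set.indicator_apply]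
  simp only [Set.mem_prod, Set.mem_setOf_eq]
  by_cases hα : Valued.v α ≤ Valued.v (toPlace v w₀ π) ^ n <;>
  by_cases hβ : Valued.v β = Valued.v (toPlace v w₀ π) ^ n <;>
  by_cases hγ : Valued.v γ ≤ Valued.v (toPlace v w₀ π) ^ (n + k) <;>
  simp [hα, hβ, hγ]

/-! ## §4 The (M2b) side letters of the three sets -/

include hπ in
/-- **`hB`**: the ball `{v ≤ P^m}` is (the carrier of) an additive subgroup of `E_{w₀}` (★ `primePowBall` through ★ `exists_setOf_valued_le_eq_primePowBall`).
[cite: CasselsFrohlichANT1967, Ch. II §10] -/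
theorem exists_addSubgroup_ball (m : ℤ) : ∃ B : AddSubgroup (w₀.1.adicCompletion E), ∀ z, z ∈ B ↔ Valued.v z ≤ Valued.v (toPlace v w₀ π) ^ m := by
  obtain ⟨m', hm'⟩ := exists_setOf_valued_le_eq_primePowBall F E v hπ m w₀
  refine ⟨{ carrier := primePowBall (w₀.1.adicCompletion E) m'
            add_mem' := fun hx hy => add_mem_primePowBall hx hy
            zero_mem' := zero_mem_primePowBall m'
            neg_mem' := fun hx => neg_mem_primePowBall hx }, fun z => ?_⟩
  change z ∈ primePowBall (w₀.1.adicCompletion E) m' ↔ _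
  rw [← hm', Set.mem_setOf_eq]

include hπ in
/-- **`hBm`∕`hC`**: the ball `{v ≤ P^m}` is measurable (it is open, ★ `isOpen_setOf_valued_le`). [cite: CasselsFrohlichANT1967, Ch. II §10] -/
theorem measurableSet_ball [MeasurableSpace (w₀.1.adicCompletion E)] [BorelSpace (w₀.1.adicCompletion E)] (m : ℤ) :
    MeasurableSet {z : w₀.1.adicCompletion E | Valued.v z ≤ Valued.v (toPlace v w₀ π) ^ m} :=
  (isOpen_setOf_valued_le F E v hπ m w₀).measurableSet

include hπ in
/-- **`hBμ`∕`hCμ`**: the ball `{v ≤ P^m}` has finite measure for every measure finite on compacts (it is compact, ★ `isCompact_setOf_valued_le`).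
[cite: WeilBNT1967, Ch. II §5 Prop. 12] -/
theorem measure_ball_ne_top [MeasurableSpace (w₀.1.adicCompletion E)] (μ : Measure (w₀.1.adicCompletion E)) [IsFiniteMeasureOnCompacts μ] (m : ℤ) :
    μ {z : w₀.1.adicCompletion E | Valued.v z ≤ Valued.v (toPlace v w₀ π) ^ m} ≠ ∞ :=
  ((isCompact_setOf_valued_le F E v hπ m w₀).measure_lt_top).ne

include hπw in
/-- the shell is the difference of two consecutive balls. [cite: WeilBNT1967, Ch. II §5 Prop. 12] -/
theorem shell_eq_diff (m : ℤ) :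
    {z : w₀.1.adicCompletion E | Valued.v z = Valued.v (toPlace v w₀ π) ^ m} =
      {z : w₀.1.adicCompletion E | Valued.v z ≤ Valued.v (toPlace v w₀ π) ^ m} \ {z : w₀.1.adicCompletion E | Valued.v z ≤ Valued.v (toPlace v w₀ π) ^ (m + 1)} :=
  Set.ext fun z => by rw [Set.mem_sdiff, Set.mem_setOf_eq, Set.mem_setOf_eq, Set.mem_setOf_eq, valued_le_and_not_le_iff_eq F E v w₀ hπw z m]

include hπ hπw in
/-- **`hU`**: the shell `{v = P^m}` is measurable. [cite: WeilBNT1967, Ch. II §5 Prop. 12] -/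
theorem measurableSet_shell [MeasurableSpace (w₀.1.adicCompletion E)] [BorelSpace (w₀.1.adicCompletion E)] (m : ℤ) :
    MeasurableSet {z : w₀.1.adicCompletion E | Valued.v z = Valued.v (toPlace v w₀ π) ^ m} := by
  rw [shell_eq_diff F E v w₀ hπw m]
  exact (measurableSet_ball F E v hπ w₀ m).diff (measurableSet_ball F E v hπ w₀ (m + 1))

include hπ hπw in
/-- **`hUμ`**: the shell `{v = P^m}` has finite measure. [cite: WeilBNT1967, Ch. II §5 Prop. 12] -/
theorem measure_shell_ne_top [MeasurableSpace (w₀.1.adicCompletion E)] (μ : Measure (w₀.1.adicCompletion E)) [IsFiniteMeasureOnCompacts μ] (m : ℤ) :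
    μ {z : w₀.1.adicCompletion E | Valued.v z = Valued.v (toPlace v w₀ π) ^ m} ≠ ∞ := by
  rw [shell_eq_diff F E v w₀ hπw m]
  exact (lt_of_le_of_lt (measure_mono Set.sdiff_subset) (isCompact_setOf_valued_le F E v hπ m w₀).measure_lt_top).ne

include hπ in
/-- **`hUsh`**: on the shell, `b ≠ 0` and `v b = P^m` (`ρ′ := P^m`). [cite: WeilBNT1967, Ch. II §5 Prop. 12] -/
theorem shell_letter (m : ℤ) :
    ∀ b ∈ {z : w₀.1.adicCompletion E | Valued.v z = Valued.v (toPlace v w₀ π) ^ m}, b ≠ 0 ∧ Valued.v b = Valued.v (toPlace v w₀ π) ^ m := fun b hb =>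
  ⟨fun h0 => zpow_ne_zero m (valued_toPlace_uniformizer_ne_zero F E v hπ w₀)
    (by rw [← (hb : Valued.v b = Valued.v (toPlace v w₀ π) ^ m), h0, map_zero]), hb⟩

include hπ in
/-- **`hCbox` — THE `D`-DEATH ON THE DEEP BALL**: for a `v`-isometric `σ` and `v(D)·P^{2k} ≤ 1`, every `γ` with `v γ ≤ P^{n+k}` has `v(D·γ·σγ) ≤ P^n·P^n` (so ★ (R-c)
`box_condition` kills the `D_ε`-term for BOTH frames). [cite: Kudla1994, §3 Thm. 3.1] [cite: KudlaSweet1997, §1] -/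
theorem ball_box_letter {σ : w₀.1.adicCompletion E →+* w₀.1.adicCompletion E} (hσv : ∀ z, Valued.v (σ z) = Valued.v z) {D : w₀.1.adicCompletion E} {n : ℤ} {k : ℕ}
    (hD : Valued.v D * Valued.v (toPlace v w₀ π) ^ (2 * (k : ℤ)) ≤ 1) :
    ∀ c ∈ {z : w₀.1.adicCompletion E | Valued.v z ≤ Valued.v (toPlace v w₀ π) ^ (n + k)},
      Valued.v (D * c * σ c) ≤ Valued.v (toPlace v w₀ π) ^ n * Valued.v (toPlace v w₀ π) ^ n := by
  intro c hc
  have hP : Valued.v (toPlace v w₀ π) ≠ 0 := valued_toPlace_uniformizer_ne_zero F E v hπ w₀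
  rw [Set.mem_setOf_eq] at hc
  rw [map_mul, map_mul, hσv]
  calc Valued.v D * Valued.v c * Valued.v c
      ≤ Valued.v D * Valued.v (toPlace v w₀ π) ^ (n + k) * Valued.v (toPlace v w₀ π) ^ (n + k) :=
        mul_le_mul' (mul_le_mul' le_rfl hc) hc
    _ = (Valued.v D * Valued.v (toPlace v w₀ π) ^ (2 * (k : ℤ))) * (Valued.v (toPlace v w₀ π) ^ n * Valued.v (toPlace v w₀ π) ^ n) := by
        rw [mul_assoc (Valued.v D), ← zpow_add₀ hP, ← zpow_add₀ hP, mul_assoc (Valued.v D), ← zpow_add₀ hP]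
        congr 2
        ring
    _ ≤ 1 * (Valued.v (toPlace v w₀ π) ^ n * Valued.v (toPlace v w₀ π) ^ n) := mul_le_mul' hD le_rfl
    _ = Valued.v (toPlace v w₀ π) ^ n * Valued.v (toPlace v w₀ π) ^ n := one_mul _

include hπ in
/-- the depth condition: `v(D) ≤ P^{−j}` and `j ≤ 2k` give `v(D)·P^{2k} ≤ 1` — at `v ∤ 2`, `|D_ε∕2| = |D_ε| ≤ 1` (`j = 0`, any `k`); at a dyadic `w₀`, `|D_ε∕2| ≤ P^{−ord_{w₀}2}`
(`j = ord_{w₀} 2 ≤ 2k`). [cite: CasselsFrohlichANT1967, Ch. II §10] -/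
theorem valued_mul_zpow_le_one {D : w₀.1.adicCompletion E} {j : ℤ} {k : ℕ} (hD : Valued.v D ≤ Valued.v (toPlace v w₀ π) ^ (-j)) (hjk : j ≤ 2 * (k : ℤ)) :
    Valued.v D * Valued.v (toPlace v w₀ π) ^ (2 * (k : ℤ)) ≤ 1 := by
  have hP : Valued.v (toPlace v w₀ π) ≠ 0 := valued_toPlace_uniformizer_ne_zero F E v hπ w₀
  have hP1 : Valued.v (toPlace v w₀ π) ≤ 1 := valued_toPlace_uniformizer_le_one F E v hπ w₀
  calc Valued.v D * Valued.v (toPlace v w₀ π) ^ (2 * (k : ℤ))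
      ≤ Valued.v (toPlace v w₀ π) ^ (-j) * Valued.v (toPlace v w₀ π) ^ (2 * (k : ℤ)) := mul_le_mul' hD le_rfl
    _ = Valued.v (toPlace v w₀ π) ^ (2 * (k : ℤ) - j) := by rw [← zpow_add₀ hP]; congr 1; ring
    _ ≤ 1 := zpow_le_one₀ (zero_lt_iff.2 hP) hP1 (by omega)

end Summit.HodgeConjecture.HodgeConjecture.Cruxes.HLiu418.K2LiuWitnessLeviReading

end
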